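import Mathlib
import Summits.NavierStokesRegularity.NavierStokesRegularity.Theorems.HeteroclinicTriggerChainTriggerChainFrontStepConnectionForm
import HarnessLib

/-!
# `HeteroclinicTriggerChain` — crux `TriggerChainFrontStep` (item stmt-NavierStokesRegularity-22785):
  analytic consequences of the (connection) clause, III — JUNK-FREE connections are the logistic arc

Setting of `…ConnectionForm`. For a JUNK-FREE connection (`H j 0 ≡ 0` for `j ∉ {i₀,i₁}`; by
`…ConnectionJunkFree` this holds as soon as the trigger's self-interaction feeds no junk mode, and it
holds for the witness table of `TriggerChainTable`) the (connection) clause pins the active block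
completely:

* `htcCX_selfInteraction_zero` — conversely, junk-freeness forces `α i₁ i₁ j (0,0,0) = α i₁ i₁ j (0,0,1) = 0`
  for `j ∉ {i₀,i₁}` together with their (4.2)/(4.3) partners `α i₁ j i₁ (0,0,0) = α j i₁ i₁ (0,0,0) =
  α i₁ j i₁ (0,1,0) = α j i₁ i₁ (1,0,0) = 0` (the trigger needs `u ≢ 0`, supplied by the crux's lower
  bound `K⁻¹e^{et} ≤ |u|`);
* `htcCX_transfer_eq_trigger` — COMPLETE TRANSFER FORCES `g = e`: `α i₁ i₁ i₀ (0,0,1) = d i₁ 0`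
  (`g·x + e·y` is conserved on a junk-free connection and tends to `g` resp. `e` at `∓∞`);
* `htcCX_arc` — the connection is the logistic arc: `x' = -e u²`, `u' = e x u - e u y`, `y' = e u²`,
  `x + y = 1`, `x² + u² + y² = 1`, `u² = 2xy`, `0 ≤ x, y ≤ 1` (so the tree's closed form
  `heteroclinicTriggerChain_arc_logistic` and `rung_complete_transfer` apply to EVERY admissible `H`);
* `htcCX_sigma_symm_cancelling`, `htcCX_quadTerm_seed_row`, `htcCX_seed_coeff_ne_zero` — the seed table
  `σ` is symmetric and cancelling, its force on the upper trigger along `H` is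
  `(σ i₀ i₁ i₁ (0,0,1) + σ i₁ i₀ i₁ (0,0,1))·x·u`, so the (seed) clause says exactly that this
  coefficient is nonzero.

CONSEQUENCE FOR THE LINE (lead skeleton `Cruxes/TriggerChainFrontStep/Lines/gapdata_v2.lean`): on
junk-free connections the `{i₀,i₁}` sector of `α₀` IS the three-orbit design of `TriggerChainTable` with
`e = g`; the only `O(1)` couplings of `α₀` invisible to every clause and active on chain states are the
overlap triads `{(i₁,n), (i₁,n+1), (j,n)}`, `j ∉ {i₀,i₁}` (slots `(0,1,0)/(1,0,0)` into a junk output),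
which the normal form, parity and the connection do not constrain.

HONEST FRAMING: elementary ODE/algebra about a Tao-type MODEL lattice table (Tao 2016 §4); helper for
the crux, no stub credit; nothing here is a statement about the Navier–Stokes equations; no summit,
rung or crux is proved by this file.
-/

noncomputable section

set_option linter.dupNamespace false

namespace Summit.NavierStokesRegularity.NavierStokesRegularity.Theorems

open Filter Topology Set Literature.Analysis.FluidPDE Literature.Analysis.FluidPDE.TaoCascade

/-- The derivative of an identically vanishing row vanishes: if `H j n ≡ 0` and `H` is an exact family,
`quadTerm 1 α H j n t = 0`. [folklore] -/
theorem htcCX_quadTerm_eq_zero_of_row_zero {α : Fin 4 → Fin 4 → Fin 4 → ℤ × ℤ × ℤ → ℝ}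
    {H : Fin 4 → ℤ → ℝ → ℝ} (hH : ∀ i n t, HasDerivAt (H i n) (quadTerm 1 α H i n t) t)
    {j : Fin 4} {n : ℤ} (hz : ∀ t, H j n t = 0) (t : ℝ) : quadTerm 1 α H j n t = 0 := by
  have hfun : H j n = fun _ => (0 : ℝ) := funext hz
  have h := hH j n t
  rw [hfun] at h
  exact h.unique (hasDerivAt_const t (0 : ℝ))

/-- **Junk-freeness forces the trigger's self-interaction rows into junk modes to vanish**, with their
(4.2)/(4.3) partners. [this file] -/
theorem htcCX_selfInteraction_zero (α : Fin 4 → Fin 4 → Fin 4 → ℤ × ℤ × ℤ → ℝ) (i₀ i₁ : Fin 4)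
    (d : Fin 4 → ℤ → ℝ) (e K : ℝ) (hne : i₀ ≠ i₁) (hK : 0 < K)
    (hsym : IsSymmetricCoeff α) (hcanc : IsCancellingCoeff α)
    (hpure : ∀ X : Fin 4 → ℤ → ℝ → ℝ, (∀ i n t, i ≠ i₀ → X i n t = 0) →
      ∀ i n t, quadTerm 1 α X i n t = 0)
    (hpar : ∀ (j₁ j₂ j₃ : Fin 4) (μ : ℤ × ℤ × ℤ), Xor (Xor (j₁ = i₁) (j₂ = i₁)) (j₃ = i₁) →
      α j₁ j₂ j₃ μ = 0)
    (hsad : ∀ (Y : Fin 4 → ℤ → ℝ → ℝ) (i : Fin 4) (n : ℤ) (t : ℝ),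
      quadTerm 1 α (fun j m s => (fun j m (_ : ℝ) => if j = i₀ ∧ m = 0 then (1 : ℝ) else 0) j m s +
          Y j m s) i n t -
        quadTerm 1 α (fun j m (_ : ℝ) => if j = i₀ ∧ m = 0 then (1 : ℝ) else 0) i n t -
        quadTerm 1 α Y i n t = d i n * Y i n t)
    (H : Fin 4 → ℤ → ℝ → ℝ)
    (hH : ∀ i n t, HasDerivAt (H i n) (quadTerm 1 α H i n t) t)
    (hneg : ∀ i n t, n < 0 → H i n t = 0) (hone : ∀ i n t, 1 ≤ n → i ≠ i₀ → H i n t = 0)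
    (htwo : ∀ i n t, 2 ≤ n → H i n t = 0)
    (hlow : ∀ t : ℝ, t ≤ 0 → K⁻¹ * Real.exp (e * t) ≤ |H i₁ 0 t|)
    (hHj : ∀ (j : Fin 4) (t : ℝ), j ≠ i₀ → j ≠ i₁ → H j 0 t = 0)
    (j : Fin 4) (hj0 : j ≠ i₀) (hj1 : j ≠ i₁) :
    α i₁ i₁ j (0, 0, 0) = 0 ∧ α i₁ i₁ j (0, 0, 1) = 0 ∧ α i₁ j i₁ (0, 0, 0) = 0 ∧
      α j i₁ i₁ (0, 0, 0) = 0 ∧ α i₁ j i₁ (0, 1, 0) = 0 ∧ α j i₁ i₁ (1, 0, 0) = 0 := by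
  obtain ⟨hX, hX1⟩ := htcCF_support hneg hone htwo (0 : ℝ)
  have hrows := htcCA_quadTerm_junk α i₀ i₁ d hne hsym hcanc hpure hpar hsad H 0 hX hX1
    (fun k hk0 hk1 => hHj k 0 hk0 hk1) j hj1
  have hu0 : H i₁ 0 0 ≠ 0 := by
    have h := hlow 0 le_rfl
    rw [mul_zero, Real.exp_zero, mul_one] at h
    have hKi : 0 < K⁻¹ := inv_pos.2 hK
    intro hz
    rw [hz, abs_zero] at h
    linarith
  have hu2 : H i₁ 0 0 ^ 2 ≠ 0 := pow_ne_zero 2 hu0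
  have q0 : quadTerm 1 α H j 0 0 = 0 :=
    htcCX_quadTerm_eq_zero_of_row_zero hH (fun t => hHj j t hj0 hj1) 0
  have q1 : quadTerm 1 α H j 1 0 = 0 :=
    htcCX_quadTerm_eq_zero_of_row_zero hH (fun t => hone j 1 t le_rfl hj0) 0
  have b0 : α i₁ i₁ j (0, 0, 0) = 0 := by
    have h := hrows.1
    rw [q0] at h
    rcases mul_eq_zero.1 h.symm with h' | h'
    · exact h'
    · exact absurd h' hu2
  have b1 : α i₁ i₁ j (0, 0, 1) = 0 := by
    have h := hrows.2
    rw [q1] at h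
    rcases mul_eq_zero.1 h.symm with h' | h'
    · exact h'
    · exact absurd h' hu2
  have m000 : ((0 : ℤ), (0 : ℤ), (0 : ℤ)) ∈ shiftSet := by decide
  have m001 : ((0 : ℤ), (0 : ℤ), (1 : ℤ)) ∈ shiftSet := by decide
  have m010 : ((0 : ℤ), (1 : ℤ), (0 : ℤ)) ∈ shiftSet := by decide
  have c0 := hcanc i₁ i₁ j 0 0 0 m000
  have s0 := hsym i₁ j i₁ 0 0 0 m000
  have c1 := hcanc i₁ i₁ j 0 0 1 m001
  have s1 := hsym i₁ j i₁ 0 1 0 m010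
  refine ⟨b0, b1, by linarith, by linarith, by linarith, by linarith⟩

/-- **COMPLETE TRANSFER FORCES `g = e` on a junk-free connection**: the transfer rate
`α i₁ i₁ i₀ (0,0,1)` equals the trigger rate `d i₁ 0`. Along a junk-free connection
`(g·x + e·y)' = -g·e·u² + e·g·u² = 0`, and `g·x + e·y → g` at `-∞`, `→ e` at `+∞`. [this file] -/
theorem htcCX_transfer_eq_trigger (α : Fin 4 → Fin 4 → Fin 4 → ℤ × ℤ × ℤ → ℝ) (i₀ i₁ : Fin 4)
    (d : Fin 4 → ℤ → ℝ)
    (hsym : IsSymmetricCoeff α) (hcanc : IsCancellingCoeff α)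
    (hpure : ∀ X : Fin 4 → ℤ → ℝ → ℝ, (∀ i n t, i ≠ i₀ → X i n t = 0) →
      ∀ i n t, quadTerm 1 α X i n t = 0)
    (hsad : ∀ (Y : Fin 4 → ℤ → ℝ → ℝ) (i : Fin 4) (n : ℤ) (t : ℝ),
      quadTerm 1 α (fun j m s => (fun j m (_ : ℝ) => if j = i₀ ∧ m = 0 then (1 : ℝ) else 0) j m s +
          Y j m s) i n t -
        quadTerm 1 α (fun j m (_ : ℝ) => if j = i₀ ∧ m = 0 then (1 : ℝ) else 0) i n t -
        quadTerm 1 α Y i n t = d i n * Y i n t)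
    (H : Fin 4 → ℤ → ℝ → ℝ)
    (hH : ∀ i n t, HasDerivAt (H i n) (quadTerm 1 α H i n t) t)
    (hneg : ∀ i n t, n < 0 → H i n t = 0) (hone : ∀ i n t, 1 ≤ n → i ≠ i₀ → H i n t = 0)
    (htwo : ∀ i n t, 2 ≤ n → H i n t = 0)
    (hbot : ∀ i n, Tendsto (H i n) atBot (𝓝 (if i = i₀ ∧ n = 0 then (1 : ℝ) else 0)))
    (htop : ∀ i n, Tendsto (H i n) atTop (𝓝 (if i = i₀ ∧ n = 1 then (1 : ℝ) else 0)))
    (hHj : ∀ (j : Fin 4) (t : ℝ), j ≠ i₀ → j ≠ i₁ → H j 0 t = 0) :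
    α i₁ i₁ i₀ (0, 0, 1) = d i₁ 0 := by
  obtain ⟨nf1, -, -, -, -, -, nf7, -, -⟩ :=
    HeteroclinicTriggerChain.stub_normal_form α i₀ d hsym hcanc hpure hsad
  set g := α i₁ i₁ i₀ (0, 0, 1) with hg
  set e := d i₁ 0 with he
  -- junk-free collapse of the drain and pump sums
  have hsd : ∀ s, ∑ j, d j 0 * H j 0 s ^ 2 = e * H i₁ 0 s ^ 2 := by
    intro s
    rw [Finset.sum_eq_single i₁ (fun j _ hj => ?_) (by simp)]
    by_cases hj0 : j = i₀
    · rw [hj0, nf7 0, zero_mul]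
    · rw [hHj j s hj0 hj]; ring
  have hsg : ∀ s, ∑ j, α j j i₀ (0, 0, 1) * H j 0 s ^ 2 = g * H i₁ 0 s ^ 2 := by
    intro s
    rw [Finset.sum_eq_single i₁ (fun j _ hj => ?_) (by simp)]
    by_cases hj0 : j = i₀
    · rw [hj0, nf1 i₀ (0, 0, 1) (by decide), zero_mul]
    · rw [hHj j s hj0 hj]; ring
  set L : ℝ → ℝ := fun s => g * H i₀ 0 s + e * H i₀ 1 s with hL
  have hLd : ∀ s, HasDerivAt L 0 s := by
    intro s
    obtain ⟨hX, hX1⟩ := htcCF_support hneg hone htwo s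
    have hx := hH i₀ 0 s
    rw [htcCA_quadTerm_carrier α i₀ d hsym hcanc hpure hsad H s hX hX1, hsd s] at hx
    have hy := hH i₀ 1 s
    rw [htcCA_quadTerm_receiver α i₀ d hsym hcanc hpure hsad H s hX hX1, hsg s] at hy
    have h := (hx.const_mul g).add (hy.const_mul e)
    refine h.congr_deriv ?_
    ring
  have hdiff : Differentiable ℝ L := fun s => (hLd s).differentiableAt
  have hconst : ∀ s, L s = L 0 := fun s =>
    is_const_of_deriv_eq_zero hdiff (fun r => (hLd r).deriv) s 0
  have h0b : Tendsto (H i₀ 0) atBot (𝓝 1) := by simpa using hbot i₀ 0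
  have h1b : Tendsto (H i₀ 1) atBot (𝓝 0) := by simpa using hbot i₀ 1
  have h0t : Tendsto (H i₀ 0) atTop (𝓝 0) := by simpa using htop i₀ 0
  have h1t : Tendsto (H i₀ 1) atTop (𝓝 1) := by simpa using htop i₀ 1
  have hLb : Tendsto L atBot (𝓝 g) := by
    have h := (h0b.const_mul g).add (h1b.const_mul e)
    simpa using h
  have hLt : Tendsto L atTop (𝓝 e) := by
    have h := (h0t.const_mul g).add (h1t.const_mul e)
    simpa using h
  have hcb : Tendsto L atBot (𝓝 (L 0)) := tendsto_const_nhds.congr fun s => (hconst s).symm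
  have hct : Tendsto L atTop (𝓝 (L 0)) := tendsto_const_nhds.congr fun s => (hconst s).symm
  have h1 : g = L 0 := tendsto_nhds_unique hLb hcb
  have h2 : e = L 0 := tendsto_nhds_unique hLt hct
  rw [h1, ← h2]

/-- **A junk-free connection IS the logistic arc**: the three live amplitudes obey
`x' = -e u²`, `u' = e x u - e u y`, `y' = e u²` (with `e = d i₁ 0`, using `g = e`), and
`x + y = 1`, `x² + u² + y² = 1`, `u² = 2xy`, `0 ≤ y ≤ 1`, `0 ≤ x ≤ 1` along it. [this file] -/
theorem htcCX_arc (α : Fin 4 → Fin 4 → Fin 4 → ℤ × ℤ × ℤ → ℝ) (i₀ i₁ : Fin 4)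
    (d : Fin 4 → ℤ → ℝ) (hne : i₀ ≠ i₁)
    (hsym : IsSymmetricCoeff α) (hcanc : IsCancellingCoeff α)
    (hpure : ∀ X : Fin 4 → ℤ → ℝ → ℝ, (∀ i n t, i ≠ i₀ → X i n t = 0) →
      ∀ i n t, quadTerm 1 α X i n t = 0)
    (hpar : ∀ (j₁ j₂ j₃ : Fin 4) (μ : ℤ × ℤ × ℤ), Xor (Xor (j₁ = i₁) (j₂ = i₁)) (j₃ = i₁) →
      α j₁ j₂ j₃ μ = 0)
    (hsad : ∀ (Y : Fin 4 → ℤ → ℝ → ℝ) (i : Fin 4) (n : ℤ) (t : ℝ),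
      quadTerm 1 α (fun j m s => (fun j m (_ : ℝ) => if j = i₀ ∧ m = 0 then (1 : ℝ) else 0) j m s +
          Y j m s) i n t -
        quadTerm 1 α (fun j m (_ : ℝ) => if j = i₀ ∧ m = 0 then (1 : ℝ) else 0) i n t -
        quadTerm 1 α Y i n t = d i n * Y i n t)
    (hdle : ∀ (i : Fin 4) (n : ℤ), ¬(i = i₁ ∧ n = 0) → d i n ≤ 0)
    (hb : ∀ j : Fin 4, j ≠ i₀ → j ≠ i₁ → α i₁ i₁ j (0, 0, 0) = 0)
    (H : Fin 4 → ℤ → ℝ → ℝ)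
    (hH : ∀ i n t, HasDerivAt (H i n) (quadTerm 1 α H i n t) t)
    (hneg : ∀ i n t, n < 0 → H i n t = 0) (hone : ∀ i n t, 1 ≤ n → i ≠ i₀ → H i n t = 0)
    (htwo : ∀ i n t, 2 ≤ n → H i n t = 0)
    (hbot : ∀ i n, Tendsto (H i n) atBot (𝓝 (if i = i₀ ∧ n = 0 then (1 : ℝ) else 0)))
    (htop : ∀ i n, Tendsto (H i n) atTop (𝓝 (if i = i₀ ∧ n = 1 then (1 : ℝ) else 0)))
    (hHj : ∀ (j : Fin 4) (t : ℝ), j ≠ i₀ → j ≠ i₁ → H j 0 t = 0) (t : ℝ) :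
    (HasDerivAt (H i₀ 0) (-(d i₁ 0 * H i₁ 0 t ^ 2)) t ∧
      HasDerivAt (H i₁ 0) (d i₁ 0 * H i₀ 0 t * H i₁ 0 t - d i₁ 0 * H i₁ 0 t * H i₀ 1 t) t ∧
      HasDerivAt (H i₀ 1) (d i₁ 0 * H i₁ 0 t ^ 2) t) ∧
    H i₀ 0 t + H i₀ 1 t = 1 ∧ H i₀ 0 t ^ 2 + H i₁ 0 t ^ 2 + H i₀ 1 t ^ 2 = 1 ∧
    H i₁ 0 t ^ 2 = 2 * H i₀ 0 t * H i₀ 1 t ∧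
    (0 ≤ H i₀ 1 t ∧ H i₀ 1 t ≤ 1) ∧ (0 ≤ H i₀ 0 t ∧ H i₀ 0 t ≤ 1) := by
  obtain ⟨nf1, -, -, -, -, -, nf7, -, -⟩ :=
    HeteroclinicTriggerChain.stub_normal_form α i₀ d hsym hcanc hpure hsad
  have hge : α i₁ i₁ i₀ (0, 0, 1) = d i₁ 0 :=
    htcCX_transfer_eq_trigger α i₀ i₁ d hsym hcanc hpure hsad H hH hneg hone htwo hbot htop hHj
  have hsd : ∀ s, ∑ j, d j 0 * H j 0 s ^ 2 = d i₁ 0 * H i₁ 0 s ^ 2 := by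
    intro s
    rw [Finset.sum_eq_single i₁ (fun j _ hj => ?_) (by simp)]
    by_cases hj0 : j = i₀
    · rw [hj0, nf7 0, zero_mul]
    · rw [hHj j s hj0 hj]; ring
  have hsg : ∀ s, ∑ j, α j j i₀ (0, 0, 1) * H j 0 s ^ 2 = d i₁ 0 * H i₁ 0 s ^ 2 := by
    intro s
    rw [Finset.sum_eq_single i₁ (fun j _ hj => ?_) (by simp), hge]
    by_cases hj0 : j = i₀
    · rw [hj0, nf1 i₀ (0, 0, 1) (by decide), zero_mul]
    · rw [hHj j s hj0 hj]; ring
  have hode : ∀ s, HasDerivAt (H i₀ 0) (-(d i₁ 0 * H i₁ 0 s ^ 2)) s ∧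
      HasDerivAt (H i₁ 0) (d i₁ 0 * H i₀ 0 s * H i₁ 0 s - d i₁ 0 * H i₁ 0 s * H i₀ 1 s) s ∧
      HasDerivAt (H i₀ 1) (d i₁ 0 * H i₁ 0 s ^ 2) s := by
    intro s
    obtain ⟨hX, hX1⟩ := htcCF_support hneg hone htwo s
    have hx := hH i₀ 0 s
    rw [htcCA_quadTerm_carrier α i₀ d hsym hcanc hpure hsad H s hX hX1, hsd s] at hx
    have hu := hH i₁ 0 s
    rw [htcCA_quadTerm_trigger α i₀ i₁ d hne hsym hcanc hpure hpar hsad hb H s hX hX1, hge] at hu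
    have hy := hH i₀ 1 s
    rw [htcCA_quadTerm_receiver α i₀ d hsym hcanc hpure hsad H s hX hX1, hsg s] at hy
    exact ⟨hx, hu.congr_deriv (by ring), hy⟩
  -- x + y is conserved and equal to 1
  have hsum : ∀ s, H i₀ 0 s + H i₀ 1 s = 1 := by
    have hd : ∀ s, HasDerivAt (fun r => H i₀ 0 r + H i₀ 1 r) 0 s := fun s =>
      ((hode s).1.add (hode s).2.2).congr_deriv (by ring)
    have hdiff : Differentiable ℝ (fun r => H i₀ 0 r + H i₀ 1 r) := fun s => (hd s).differentiableAt
    have hconst : ∀ s, H i₀ 0 s + H i₀ 1 s = H i₀ 0 0 + H i₀ 1 0 := fun s =>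
      is_const_of_deriv_eq_zero hdiff (fun r => (hd r).deriv) s 0
    have h0b : Tendsto (H i₀ 0) atBot (𝓝 1) := by simpa using hbot i₀ 0
    have h1b : Tendsto (H i₀ 1) atBot (𝓝 0) := by simpa using hbot i₀ 1
    have hl : Tendsto (fun r => H i₀ 0 r + H i₀ 1 r) atBot (𝓝 (1 + 0)) := h0b.add h1b
    have hc : Tendsto (fun r => H i₀ 0 r + H i₀ 1 r) atBot (𝓝 (H i₀ 0 0 + H i₀ 1 0)) :=
      tendsto_const_nhds.congr fun s => (hconst s).symm
    have heq := tendsto_nhds_unique hc hl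
    intro s
    rw [hconst s, heq, add_zero]
  -- the energy
  have hE := htcCF_energy_eq_one α i₀ hcanc (fun i => nf1 i (0, 0, 0) (by decide)) H hH hneg hone
    htwo hbot t
  obtain ⟨-, hX1⟩ := htcCF_support hneg hone htwo t
  have e0 : ∑ i, H i 0 t ^ 2 = H i₀ 0 t ^ 2 + H i₁ 0 t ^ 2 := by
    have key : ∀ i : Fin 4, H i 0 t ^ 2 =
        (if i = i₀ then H i₀ 0 t ^ 2 else 0) + (if i = i₁ then H i₁ 0 t ^ 2 else 0) := by
      intro i
      by_cases h0 : i = i₀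
      · rw [h0, if_pos rfl, if_neg hne, add_zero]
      · by_cases h1 : i = i₁
        · rw [h1, if_neg (Ne.symm hne), if_pos rfl, zero_add]
        · rw [if_neg h0, if_neg h1, hHj i t h0 h1]; ring
    rw [Finset.sum_congr rfl fun i _ => key i, Finset.sum_add_distrib, Finset.sum_ite_eq',
      Finset.sum_ite_eq']
    simp
  have e1 : ∑ i, H i 1 t ^ 2 = H i₀ 1 t ^ 2 := by
    rw [Finset.sum_eq_single i₀ (fun i _ hi => by rw [hX1 i hi]; ring) (by simp)]
  rw [e0, e1] at hE
  obtain ⟨-, -, hy01⟩ := htcCF_receiver_monotone α i₀ i₁ d hsym hcanc hpure hsad hdle H hH hneg hone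
    htwo hbot htop
  have hxy := hsum t
  refine ⟨hode t, hxy, by linarith, ?_, hy01 t, ?_, ?_⟩
  · have hx : H i₀ 0 t = 1 - H i₀ 1 t := by linarith
    rw [hx] at hE ⊢
    nlinarith [hE]
  · linarith [(hy01 t).2]
  · linarith [(hy01 t).1]

/-- The seed table `σ` of the crux is symmetric (4.2) and cancelling (4.3): both `α₀` and `α₀ + 1·σ`
are (the table-class clauses at `β = 1`). [this file] -/
theorem htcCX_sigma_symm_cancelling (α₀ σ : Fin 4 → Fin 4 → Fin 4 → ℤ × ℤ × ℤ → ℝ)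
    (hs₀ : IsSymmetricCoeff α₀) (hc₀ : IsCancellingCoeff α₀)
    (hs₁ : IsSymmetricCoeff (fun j₁ j₂ j₃ μ => α₀ j₁ j₂ j₃ μ + 1 * σ j₁ j₂ j₃ μ))
    (hc₁ : IsCancellingCoeff (fun j₁ j₂ j₃ μ => α₀ j₁ j₂ j₃ μ + 1 * σ j₁ j₂ j₃ μ)) :
    IsSymmetricCoeff σ ∧ IsCancellingCoeff σ := by
  constructor
  · intro a b c μ₁ μ₂ μ₃ hμ
    have h0 := hs₀ a b c μ₁ μ₂ μ₃ hμ
    have h1 := hs₁ a b c μ₁ μ₂ μ₃ hμ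
    simp only [one_mul] at h1
    linarith
  · intro a b c μ₁ μ₂ μ₃ hμ
    have h0 := hc₀ a b c μ₁ μ₂ μ₃ hμ
    have h1 := hc₁ a b c μ₁ μ₂ μ₃ hμ
    simp only [one_mul] at h1
    linarith

/-- **Seed row.** For ANY four-mode table `σ` obeying the (parity) clause for the trigger mode `i₁ ≠ i₀`
and a junk-free family supported on shell `0` and the receiver, the force on the upper trigger
`(i₁, 1)` is the seed monomial: `quadTerm 1 σ X i₁ 1 t = (σ i₀ i₁ i₁ (0,0,1) + σ i₁ i₀ i₁ (0,0,1)) · x · u`.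
[this file] -/
theorem htcCX_quadTerm_seed_row (σ : Fin 4 → Fin 4 → Fin 4 → ℤ × ℤ × ℤ → ℝ) (i₀ i₁ : Fin 4)
    (hne : i₀ ≠ i₁)
    (hpar : ∀ (j₁ j₂ j₃ : Fin 4) (μ : ℤ × ℤ × ℤ), Xor (Xor (j₁ = i₁) (j₂ = i₁)) (j₃ = i₁) →
      σ j₁ j₂ j₃ μ = 0)
    (X : Fin 4 → ℤ → ℝ → ℝ) (t : ℝ) (hX : ∀ i n, n ≠ 0 → n ≠ 1 → X i n t = 0)
    (hX1 : ∀ i, i ≠ i₀ → X i 1 t = 0) (hXj : ∀ j, j ≠ i₀ → j ≠ i₁ → X j 0 t = 0) :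
    quadTerm 1 σ X i₁ 1 t =
      (σ i₀ i₁ i₁ (0, 0, 1) + σ i₁ i₀ i₁ (0, 0, 1)) * (X i₀ 0 t * X i₁ 0 t) := by
  rw [htcNF_quadTerm_expand, htcCA_gain_one_sub_one, one_mul]
  have htop : ∑ a : Fin 4, ∑ b : Fin 4,
      (σ a b i₁ (0, 0, 0) * (X a 1 t * X b 1 t) + σ a b i₁ (1, 0, 0) * (X a (1 + 1) t * X b 1 t) +
        σ a b i₁ (0, 1, 0) * (X a 1 t * X b (1 + 1) t)) = 0 := by
    refine Finset.sum_eq_zero fun a _ => Finset.sum_eq_zero fun b _ => ?_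
    rw [hX a (1 + 1) (by norm_num) (by norm_num), hX b (1 + 1) (by norm_num) (by norm_num),
      zero_mul, mul_zero, mul_zero, mul_zero, add_zero, add_zero]
    by_cases ha : a = i₀
    · rw [ha]
      by_cases hb : b = i₀
      · rw [hb, hpar i₀ i₀ i₁ (0, 0, 0) (by simp [Xor, hne]), zero_mul]
      · rw [hX1 b hb, mul_zero, mul_zero]
    · rw [hX1 a ha, zero_mul, mul_zero]
  rw [htop, mul_zero, zero_add]
  simp only [sub_self]
  have key : ∀ a b : Fin 4, σ a b i₁ (0, 0, 1) * (X a 0 t * X b 0 t) =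
      (if a = i₀ ∧ b = i₁ then σ i₀ i₁ i₁ (0, 0, 1) * (X i₀ 0 t * X i₁ 0 t) else 0) +
        (if a = i₁ ∧ b = i₀ then σ i₁ i₀ i₁ (0, 0, 1) * (X i₀ 0 t * X i₁ 0 t) else 0) := by
    intro a b
    by_cases ha1 : a = i₁
    · rw [ha1, if_neg (show ¬(i₁ = i₀ ∧ b = i₁) from fun h => hne h.1.symm), zero_add]
      by_cases hb0 : b = i₀
      · rw [hb0, if_pos (show i₁ = i₁ ∧ i₀ = i₀ from ⟨rfl, rfl⟩)]; ring
      · rw [if_neg (show ¬(i₁ = i₁ ∧ b = i₀) from fun h => hb0 h.2)]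
        by_cases hb1 : b = i₁
        · rw [hb1, hpar i₁ i₁ i₁ (0, 0, 1) (by simp [Xor]), zero_mul]
        · rw [hXj b hb0 hb1, mul_zero, mul_zero]
    · rw [if_neg (show ¬(a = i₁ ∧ b = i₀) from fun h => ha1 h.1), add_zero]
      by_cases ha0 : a = i₀
      · rw [ha0]
        by_cases hb1 : b = i₁
        · rw [hb1, if_pos (show i₀ = i₀ ∧ i₁ = i₁ from ⟨rfl, rfl⟩)]
        · rw [if_neg (show ¬(i₀ = i₀ ∧ b = i₁) from fun h => hb1 h.2),
            hpar i₀ b i₁ (0, 0, 1) (by simp [Xor, hne, hb1]), zero_mul]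
      · rw [if_neg (show ¬(a = i₀ ∧ b = i₁) from fun h => ha0 h.1), hXj a ha0 ha1, zero_mul,
          mul_zero]
  rw [Finset.sum_congr rfl fun a _ => Finset.sum_congr rfl fun b _ => key a b]
  simp only [Finset.sum_add_distrib]
  rw [htcCA_sum_sum_ite_pair, htcCA_sum_sum_ite_pair]
  ring


/-- **The (seed) clause pins the seed coefficient**: for a junk-free connection `H` of `α₀` and a table
`σ` obeying the (parity) clause, `quadTerm 1 σ H i₁ 1 ≢ 0` forces
`σ i₀ i₁ i₁ (0,0,1) + σ i₁ i₀ i₁ (0,0,1) ≠ 0`. [this file] -/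
theorem htcCX_seed_coeff_ne_zero (σ : Fin 4 → Fin 4 → Fin 4 → ℤ × ℤ × ℤ → ℝ) (i₀ i₁ : Fin 4)
    (hne : i₀ ≠ i₁)
    (hparσ : ∀ (j₁ j₂ j₃ : Fin 4) (μ : ℤ × ℤ × ℤ), Xor (Xor (j₁ = i₁) (j₂ = i₁)) (j₃ = i₁) →
      σ j₁ j₂ j₃ μ = 0)
    (H : Fin 4 → ℤ → ℝ → ℝ)
    (hneg : ∀ i n t, n < 0 → H i n t = 0) (hone : ∀ i n t, 1 ≤ n → i ≠ i₀ → H i n t = 0)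
    (htwo : ∀ i n t, 2 ≤ n → H i n t = 0)
    (hHj : ∀ (j : Fin 4) (t : ℝ), j ≠ i₀ → j ≠ i₁ → H j 0 t = 0)
    (hseed : ∃ t : ℝ, quadTerm 1 σ H i₁ 1 t ≠ 0) :
    σ i₀ i₁ i₁ (0, 0, 1) + σ i₁ i₀ i₁ (0, 0, 1) ≠ 0 := by
  obtain ⟨t, ht⟩ := hseed
  obtain ⟨hX, hX1⟩ := htcCF_support hneg hone htwo t
  rw [htcCX_quadTerm_seed_row σ i₀ i₁ hne hparσ H t hX hX1 (fun j hj0 hj1 => hHj j t hj0 hj1)] at ht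
  intro h
  rw [h, zero_mul] at ht
  exact ht rfl

end Summit.NavierStokesRegularity.NavierStokesRegularity.Theorems

end
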